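import Summits.NavierStokesRegularity.NavierStokesRegularity.Theorems.ExtremiserTransienceTwoThirdsGauge
import Summits.NavierStokesRegularity.NavierStokesRegularity.Theorems.ExtremiserTransienceTwoThirdsGaugeFar
import Summits.NavierStokesRegularity.NavierStokesRegularity.Theorems.ExtremiserTransienceLocalMaximiserVariations
import Literature.Analysis.FluidPDE.ClassicalLerayProjection
import HarnessLib

/-!
# Route `ExtremiserTransience`, crux `NearExtremalTransiencePerFlow` (stmt-NavierStokesRegularity-26567),
# LINE g10-1 «two_thirds» (ns-idea-10), stub S1a′ — BRICK 2, lemma P1: THE PIECE FIELD `curl(χ · K∗(ζw))` and its interior identities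

`--supports stmt-NavierStokesRegularity-26567` (helper; prover seat ns-net-p2 g12; design `Cruxes/…` evidence #59 on ⟨26567⟩).  The localised sharp
inequality of S1a′ (brick 2) applies the κ⋆-universality to the CUT-OFF PIECE of a divergence-free field `w` in its local Coulomb gauge:
`ψ = K ∗ (ζw)` (Biot–Savart potential of the localised field, `ζ = 1` near the piece), `Π = Γ ∗ div(ζw) = Γ ∗ (∇ζ·w)` (the harmonic remainder:
`curl ψ = ζw − ∇Π`, ns-net-p1's `curl_biotSavart_test` p721xxx), `φ = curl(χψ)` (`χ = 1` on the piece, supported slightly beyond it).  This file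
records the qualitative half:

* `pieceField_admissible` — `φ` is smooth, compactly supported (inside `tsupport χ`) and divergence free; hence it lies in the admissible class of
  the sharp constant κ⋆ (with its own height and gradient bounds, all `L²` budgets finite);
* `pieceField_interior` — at a point where `χ = 1` and `ζ = 1` nearby: `φ = w − ∇Π` near the point, `curl φ = curl w` and
  `D(curl φ) = D(curl w)` there (the gradient remainder is curl-free), and `Dφ = Dw − D∇Π`.
The quantitative half (|∇Π| ≲ √A_E/r, |ψ| ≲ √A_E log r on the layer, the `L²` gauge bounds, the junk table) is P2–P4 of the design memo.
HONEST FRAMING: vector calculus; nothing about Navier–Stokes is proved; no summit is proved by a line. [folklore]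
-/

noncomputable section

open scoped Topology InnerProductSpace RealInnerProductSpace ENNReal NNReal ContDiff
open MeasureTheory Filter Set Metric Function
open Literature.Analysis Literature.Analysis.FluidPDE
open Summit.NavierStokesRegularity.NavierStokesRegularity.Theorems.NearExtremalTransiencePerFlow.LocalMaximiser

namespace Summit.NavierStokesRegularity.NavierStokesRegularity.Theorems.NearExtremalTransiencePerFlow.TwoThirds

-- the problem directory repeats the summit name (`NavierStokesRegularity/NavierStokesRegularity`)
set_option linter.dupNamespace false
set_option linter.style.longLine false

section PieceField

variable {w : EuclideanSpace ℝ (Fin 3) → EuclideanSpace ℝ (Fin 3)} {χ ζ : EuclideanSpace ℝ (Fin 3) → ℝ}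

/-- The localised field `ζ • w` of a smooth field with a smooth compactly supported cut-off is a smooth test field. -/
theorem localised_test (hw : ContDiff ℝ (⊤ : ℕ∞) w) (hζ : ContDiff ℝ (⊤ : ℕ∞) ζ) (hζc : HasCompactSupport ζ) :
    ContDiff ℝ (⊤ : ℕ∞) (fun x => ζ x • w x) ∧ HasCompactSupport (fun x => ζ x • w x) :=
  ⟨hζ.smul hw, hζc.smul_right⟩

/-- **P1a — the piece field is admissible**: `φ = curl(χ • K∗(ζw))` is smooth, compactly supported inside `tsupport χ`, and divergence free. -/
theorem pieceField_admissible (hw : ContDiff ℝ (⊤ : ℕ∞) w) (hχ : ContDiff ℝ (⊤ : ℕ∞) χ) (hχc : HasCompactSupport χ)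
    (hζ : ContDiff ℝ (⊤ : ℕ∞) ζ) (hζc : HasCompactSupport ζ) :
    ContDiff ℝ (⊤ : ℕ∞) (curl fun x => χ x • biotSavart (fun y => ζ y • w y) x) ∧
      HasCompactSupport (curl fun x => χ x • biotSavart (fun y => ζ y • w y) x) ∧
      tsupport (curl fun x => χ x • biotSavart (fun y => ζ y • w y) x) ⊆ tsupport χ ∧
      VectorCalculus.IsDivFree (curl fun x => χ x • biotSavart (fun y => ζ y • w y) x) := by
  obtain ⟨hh, hhc⟩ := localised_test hw hζ hζc
  set F : EuclideanSpace ℝ (Fin 3) → EuclideanSpace ℝ (Fin 3) := fun x => χ x • biotSavart (fun y => ζ y • w y) x with hFdef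
  have hψ : ContDiff ℝ (⊤ : ℕ∞) (biotSavart fun y => ζ y • w y) := (contDiff_biotSavart_test hh hhc).1
  have hF : ContDiff ℝ (⊤ : ℕ∞) F := hχ.smul hψ
  -- support of the curl sits inside the support of the field, hence inside `tsupport χ`
  have hs1 : Function.support (curl F) ⊆ Function.support (fderiv ℝ F) := by
    intro x hx
    rw [Function.mem_support] at hx ⊢
    intro h0
    apply hx
    rw [curl_eq_curlCLM, h0, map_zero]
  have hs2 : Function.support F ⊆ Function.support χ := by
    intro x hx
    rw [Function.mem_support] at hx ⊢
    intro h0; apply hx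
    show χ x • biotSavart (fun y => ζ y • w y) x = 0
    rw [h0, zero_smul]
  have hsub : tsupport (curl F) ⊆ tsupport χ :=
    ((closure_mono hs1).trans (tsupport_fderiv_subset ℝ)).trans (closure_mono hs2)
  refine ⟨contDiff_curl_top hF, ?_, hsub, isDivFree_curl hF⟩
  exact IsCompact.of_isClosed_subset hχc (isClosed_tsupport _) hsub

/-- **P1b — interior identities**.  At a point `x` near which `χ = 1` and `ζ = 1`, the piece field agrees near `x` with `w − ∇Π`,
`Π = Γ ∗ div(ζw)`; consequently `curl φ x = curl w x`, `D(curl φ)(x) = D(curl w)(x)` and `Dφ(x) = Dw(x) − D(∇Π)(x)`. -/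
theorem pieceField_interior (hw : ContDiff ℝ (⊤ : ℕ∞) w) (hζ : ContDiff ℝ (⊤ : ℕ∞) ζ) (hζc : HasCompactSupport ζ)
    {x : EuclideanSpace ℝ (Fin 3)} (hχx : ∀ᶠ y in 𝓝 x, χ y = 1) (hζx : ∀ᶠ y in 𝓝 x, ζ y = 1) :
    (∀ᶠ y in 𝓝 x, curl (fun z => χ z • biotSavart (fun y => ζ y • w y) z) y =
        w y - gradient (fun z => ∫ y, newtonKernel (z - y) * VectorCalculus.divergence (fun y => ζ y • w y) y) y) ∧
      curl (curl fun z => χ z • biotSavart (fun y => ζ y • w y) z) x = curl w x ∧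
      fderiv ℝ (curl (curl fun z => χ z • biotSavart (fun y => ζ y • w y) z)) x = fderiv ℝ (curl w) x ∧
      fderiv ℝ (curl fun z => χ z • biotSavart (fun y => ζ y • w y) z) x =
        fderiv ℝ w x - fderiv ℝ (gradient (fun z => ∫ y, newtonKernel (z - y) * VectorCalculus.divergence (fun y => ζ y • w y) y)) x := by
  obtain ⟨hh, hhc⟩ := localised_test hw hζ hζc
  set h : EuclideanSpace ℝ (Fin 3) → EuclideanSpace ℝ (Fin 3) := fun y => ζ y • w y with hhdef
  set ψ : EuclideanSpace ℝ (Fin 3) → EuclideanSpace ℝ (Fin 3) := biotSavart h with hψdef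
  set Pot : EuclideanSpace ℝ (Fin 3) → ℝ := fun z => ∫ y, newtonKernel (z - y) * VectorCalculus.divergence h y with hPotdef
  have hψ : ContDiff ℝ (⊤ : ℕ∞) ψ := (contDiff_biotSavart_test hh hhc).1
  -- smoothness of the harmonic remainder
  have hdiv : ContDiff ℝ (⊤ : ℕ∞) (VectorCalculus.divergence h) := contDiff_divergence_of_contDiff_top hh
  have hdivc : HasCompactSupport (VectorCalculus.divergence h) := hasCompactSupport_divergence hhc
  have hPot : ContDiff ℝ (⊤ : ℕ∞) Pot := contDiff_newtonPotential_of_test hdiv hdivc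
  have hPot2 : ContDiff ℝ 2 Pot := hPot.of_le (by norm_cast)
  have hgradPot : ContDiff ℝ (⊤ : ℕ∞) (gradient Pot) := contDiff_gradient_of_contDiff_top hPot
  -- (1) `curl(χψ) = curl ψ` near `x` (since `χψ = ψ` near `x`), and `curl ψ = h − ∇Π` everywhere, and `h = w` near `x`
  have hloc1 : (fun z => χ z • ψ z) =ᶠ[𝓝 x] ψ := by
    filter_upwards [hχx] with y hy
    rw [hy, one_smul]
  have hcurlψ : ∀ y, curl ψ y = h y - gradient Pot y := fun y => curl_biotSavart_test hh hhc y
  have hhw : h =ᶠ[𝓝 x] w := by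
    filter_upwards [hζx] with y hy
    show ζ y • w y = w y
    rw [hy, one_smul]
  -- eventual equality of the curls on a neighbourhood
  have hev : ∀ᶠ y in 𝓝 x, curl (fun z => χ z • ψ z) y = w y - gradient Pot y := by
    have h1 : ∀ᶠ y in 𝓝 x, (fun z => χ z • ψ z) =ᶠ[𝓝 y] ψ := hloc1.eventually_nhds
    have h2 : ∀ᶠ y in 𝓝 x, h y = w y := hhw
    filter_upwards [h1, h2] with y hy1 hy2
    rw [curl_eq_curlCLM, hy1.fderiv_eq, ← curl_eq_curlCLM, hcurlψ y, hy2]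
  refine ⟨hev, ?_, ?_, ?_⟩
  · -- `curl φ x = curl w x`
    have hev' : curl (fun z => χ z • ψ z) =ᶠ[𝓝 x] fun y => w y - gradient Pot y := hev
    rw [curl_eq_curlCLM, hev'.fderiv_eq, ← curl_eq_curlCLM]
    rw [curl_sub ((hw.differentiable (by simp)) x) ((hgradPot.differentiable (by simp)) x), curl_gradient_eq_zero_holds Pot hPot2 x, sub_zero]
  · -- `D(curl φ)(x) = D(curl w)(x)`: the curls agree on a neighbourhood
    have hcurl_ev : curl (curl fun z => χ z • ψ z) =ᶠ[𝓝 x] curl w := by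
      have h1 : ∀ᶠ y in 𝓝 x, curl (fun z => χ z • ψ z) =ᶠ[𝓝 y] fun y => w y - gradient Pot y := hev.eventually_nhds
      filter_upwards [h1] with y hy
      rw [curl_eq_curlCLM, hy.fderiv_eq, ← curl_eq_curlCLM]
      rw [curl_sub ((hw.differentiable (by simp)) y) ((hgradPot.differentiable (by simp)) y), curl_gradient_eq_zero_holds Pot hPot2 y, sub_zero]
    exact hcurl_ev.fderiv_eq
  · -- `Dφ(x) = Dw(x) − D(∇Π)(x)`
    have hev' : curl (fun z => χ z • ψ z) =ᶠ[𝓝 x] fun y => w y - gradient Pot y := hev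
    rw [hev'.fderiv_eq]
    exact fderiv_sub ((hw.differentiable (by simp)) x) ((hgradPot.differentiable (by simp)) x)

end PieceField

end Summit.NavierStokesRegularity.NavierStokesRegularity.Theorems.NearExtremalTransiencePerFlow.TwoThirds

end
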